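import Mathlib
import HarnessLib
import HarnessLib.Audit
import Summits.Parity.Statement
import Literature.NumberTheory.Sieve.FordMaynardLevelHalfThresholds
import Literature.Barriers.Parity.FordMaynardPrimeSieves
import HarnessLib.Audit.Status.Attr

/-!
Route: FordMaynardNoSieveConst0164

CLOSED (proved) 2026-08-31T17:16:29Z by operator:999:3924921 — reason: proved:Summit.Parity.GeneralizedHardyLittlewood.Theses.FordMaynardNoSieveConst0164.noSieveConst0164_proof — note: success close on decomp-parity-writer-1 g25 READY line (REQUESTS l.68358): target stmt-Parity-19101 closed·proved p828837 (40ed657128e3) + 19102 p828112; route finish ALL PROVED; D41/D42 precedent; operator priority31b. The file is kept as the record of this route; refuted decls are indexed as negative knowledge (`ledger negatives`).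

# Route FordMaynardNoSieveConst0164 — no positive linear-sieve constant at (1/2, 0, 0.164) from a
certified negative Type-I* witness

RUNG ROUTE (D-0059/D-0061, class rung; closes the rung leaf
`Summit.Parity.GeneralizedHardyLittlewood.NoLowerSieveConst0164 :=
FordMaynard.NoLowerSieveConstAt (41/250)` — Ford–Maynard Theorem 2.7 (c) moved from 0.1616 to 0.164:
NO c > 0 is an admissible
lower-bound linear-sieve constant at (γ, θ, ν) = (1/2, 0, 0.164); never summit credit). It suffices
to show X = X1, given X2 (PROVED by
this seat, kept as the rank-3 item for the crux floor): X1 (NegWitness0164, the certificate): a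
negative Type-I* witness at
(η, γ) = (41/250, 1/2) — a symmetric, bounded, piecewise-Lipschitz vector function supported on {all
components ≥ 0.164, sum 1} satisfying
the Type-I identity at level 1/2, with f(1) < −1 and f ≥ −1 on every vector of dimension ≥ 2; X2
(PrimeFreeOfWitnessAtEta, Theorem
6.3 (b) in exact form at P = (γ, 0, η)): such a witness makes every B prime-free admissible for (γ,
0, η). The landed
`IsLowerSieveConst.nonpos_of_primeFreeAdmissible` (p405250) turns that into the leaf. The b-side of
the window (positive constant from
0.1651) is NOT in this route (no Theorem 7.3 (a)/Lemma 8.4 layer yet; ROUTES-PLAN line 3). No idea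
card is realised (cell instrument line).
Lean: `Literature.NumberTheory.Sieve.FordMaynard.TypeIStarNegWitness (41 / 250) (1 / 2)`

## Assembly
Pure logic: given c with IsLowerSieveConst (1/2) 0 (41/250) c, apply NonposOfPrimeFree (= the landed
`IsLowerSieveConst.nonpos_of_primeFreeAdmissible`, p405250) to the family B ↦
PrimeFreeOfWitnessAtEta (1/2) (41/250) _ _ _ _ NegWitness0164 B.
That 3-line argument is the ASSEMBLY item (PROVED: `assembly_holds` in SketchF3.lean, rc 0, std
axioms) and the deciding theorem is
`closes (hA : Assembly) (h1 : NegWitness0164) (h2 : PrimeFreeOfWitnessAtEta) (h3 :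
NonposOfPrimeFree) : NoSieveConst0164 := hA h1 h2 h3` (glue.lean), so that
every declared item is in the cone of `closes` (BC6). Until the target is registered as ALT-CLOSER
the gate reads this as conclusion-mismatch
and the route is DRAFT by design; `ledger route edit <id> --closes-target <registered FQN>
--closes-file glue.lean` then serves it.

CLOSES_TARGET: closes rung F-P1 of Parity: Summit.Parity.GeneralizedHardyLittlewood.Theses.FordMaynardNoSieveConst0164.NoSieveConst0164 (D-0061; not the summit Statement) — the deciding theorem of this route concludes that registered leaf instead of the Statement decl `GeneralizedHardyLittlewood` (class rung: servable and labelled, never counted as concluding the summit Statement).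

Rationale: WHY THIS LINE. Ford–Maynard (arXiv:2407.14368, Theorem 2.7) locate the true threshold ν*(1/2, 0) of
the linear sieve with full level-1/2 Type-I and
Type-II information in (ν, 2ν] ∪ [1−2ν, 1−ν] only inside the window (0.1616, 0.1663], both ends by
80-digit Mathematica LPs (their f and
g, §7–8 and the ancillary files). The cell re-solved the (c)-side LP on a finer cell-step family and
CERTIFIED (exact rationals + Arb
balls, kit j243625, refereed PASS—REPRODUCED j244135) a witness with f(1) = −1.00447 ± 6·10⁻¹¹ at ν₀
= 41/250: the first statement about
ν*(1/2, 0) not in print. Every analytic input of the deduction is ALREADY PROVED in the tree — the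
tweak/fragmentation apparatus
(`FordMaynard.tweak`, `fragRel_tweak`, `typeIIdentity_tweak`, `abs_tweak_sub_le`), the prime-free
construction
`FordMaynard.primeFreeAdmissible_of_vecFn` (Theorem 6.3 (a) route of §9) and the passage to
constants (p405250) — so the rung is a
KERNEL theorem modulo (X1) an exact replay of a finite certificate: (X2), the 150-line variant of
the landed
`FordMaynardPrimeFreeOfTypeIStar_holds` in which the Type-II range is [0, η] instead of a shrinking
[θ, θ+ν₀(γ)], was PROVED by
this seat on 2026-08-25 (bc/PrimeFreeOfWitnessAtEta_holds.lean, rc 0) and is filed as a provable-now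
support. Imported area: LP duality
/ certified computation (interval arithmetic) pointed at sieve theory; no other area applies to a
numerical threshold.

RANKED CRUXES. #0 NoSieveConst0164 (target) — the rung leaf itself, as this route's target item: no
c > 0 is an admissible lower-bound linear-sieve constant at (γ, θ, ν) = (1/2, 0, 41/250) — identical
by `rfl` to the operator leaf `Summit.Parity.GeneralizedHardyLittlewood.NoLowerSieveConst0164`
if/when that is landed; registered (or to be registered) as the rung's ALT-CLOSER (D-0061), after
which `route edit --closes-target` makes the route served. (why it might fail: only if the
certificate NegWitness0164 is wrong (margin 0.0045, Arb radius 6·10⁻¹¹) — the two other items are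
PROVED.) [FordMaynard2024PrimeSieves, arXiv:2407.14368]
#2 NegWitness0164 (crux) — there is f ∈ 𝔉*_η(γ) for η = 41/250, γ = 1/2 (symmetric, supported on
{all ξᵢ ≥ η, Σξᵢ = 1}, bounded, piecewise Lipschitz, Type-I identity at level 1/2) with f(1) < −1
and f(β) ≥ −1 for every β of dimension ≥ 2 — the fsl-extension of the cell's certified LP optimum F₀
(spec fspec_41_250_m24.json: F₀(1) = −1.0044719185 ± 6.1e−11, F₀ ≥ −1 on the 73 cell families, kit
j243625 / j244135). [difficulty: L] (why it might fail: the margin is 0.0045: the exact replay must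
bound the dimension-3..6 fragmentation integrals of the step data against the 𝓛-weights to < 4·10⁻³
total, and `MemTypeIStar.typeI` must hold EXACTLY (fsl-extension), not to Arb tolerance.)
[FordMaynard2024PrimeSieves, arXiv:2407.14368]
#3 PrimeFreeOfWitnessAtEta (crux) — Theorem 6.3 (b) in exact form at P = (γ, 0, η): for 0 < γ < 1
and 0 < ν₀ < 1, a negative Type-I* witness at (ν₀, γ) makes every B > 0 prime-free admissible for
(γ, 0, ν₀) (some w_n with the Type-I bound at level γ, the Type-II bound on [0, ν₀], Σ_{n ≤ x} w_n ≥
(1 − o(1)) x/log x and no prime n^{1/B} ≤ p ≤ n in the support). PROVED by this seat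
(bc/PrimeFreeOfWitnessAtEta_holds.lean: the tree's Theorem 9.1 proof
`FordMaynardPrimeFreeOfTypeIStar_holds` with the Type-II bad interval replaced by the EDGE [η, η+ε]
— on the tweak's support all components are ≥ η, so any proper subsum ≤ η+ε is a bad singleton — 136
lines, farm rc 0, 0 sorries, std axioms); kept as the rank-3 item only because the rung is ONE
certificate after the proved reductions (crux floor) — closable on day 1 by landing that file.
[difficulty: provable-now] (why it might fail: it cannot — PROVED
(bc/PrimeFreeOfWitnessAtEta_holds.lean, rc 0, std axioms); the only residual risk is a farm/Mathlib
drift before a prover lands the file (the proof uses only FordMaynardTweak/Construction lemmas by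
name).) [FordMaynard2024PrimeSieves, arXiv:2407.14368]
#9 NonposOfPrimeFree (support) — the passage from prime-free admissible sequences to constants
(Ford–Maynard's reading `C⁻(P) = 0`, Definition 4.8): if for every B > 0 some (γ, θ, ν)-admissible
weight sequence of mass ≥ (1 − o(1)) x/log x carries no prime, then every admissible lower-bound
sieve constant c at (γ, θ, ν) is ≤ 0. PROVED in the tree as
`IsLowerSieveConst.nonpos_of_primeFreeAdmissible` (p405250, module
Literature.NumberTheory.Sieve.FordMaynardNoLowerSieveConst); filed as a by-name support (one
`exact`) so that the route file does not import that module (farm build of it pending at filing).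
[difficulty: provable-now] [FordMaynard2024PrimeSieves, arXiv:2407.14368]

TWO-LAYER PLAN. TYPED AND GLUED ALREADY (bc/NegWitness0164_birth.lean, rc 0, sorry only in the
certificate stub): NegWitness0164 ⇐ TweakNeg0164 :=
`∃ F₀ : VecFn, F₀.IsSymmetric ∧ (∀ k, IsPiecewiseLipschitz (F₀ k)) ∧ (support ⊆ {all ξᵢ ≥ 41/250, Σ
ξᵢ = 1}) ∧ h 1 1 < −1 ∧ ∀ k ≥ 2, ∀ β, −1 ≤ h k β`
with `h := FordMaynard.tweak (1/2) (41/250) Fin.elim0 Fin.elim0 F₀` (the tree's tweak with the EMPTY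
bad family = the fsl-extension), via the
PROVED `memTypeIStar_tweak` (isSymmetric_tweak + tweak_support + exists_bound_tweak +
isPiecewiseLipschitz_tweak + typeIIdentity_tweak:
the extension of admissible raw data is in 𝔉*_η(γ)) and `negWitness0164_of_tweakNeg : TweakNeg0164 →
NegWitness0164` (std axioms). Inside
TweakNeg0164 the prover's three blocks (lemmas `--supports NegWitness0164`, never items): (i) small
vectors (all βᵢ < 1/2): `fragOp_apply_of_small`
gives h = F₀ there, so "F₀ ≥ −1 on its cells" is a rational table check; (ii) k ≥ 2 with one βⱼ ≥
1/2: `fragOp_eq_multiSlice` turns h k β into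
Σ_cells F₀(cell) · (cell integral of `blockWeight (1/2)` = 𝓛_{1/2}(u)/(k'! Π uᵢ)), to be bounded ≥
−1 with certified enclosures of finitely many
polylogarithmic cell integrals (the cell's Arb values, evidence/fm27_fcert.py F3/F4); (iii) k = 1:
the same expansion of h 1 1 over fragmentations
of 1 into 2..6 pieces ≥ η must be < −1 (certified value −1.00447, margin 4.5·10⁻³). A formal
`--split` is not needed (k = 1 child + proved glue).

KILL CRITERIA. A proof of `∃ c > 0, IsLowerSieveConst (1/2) 0 (41/250) c` (e.g. a certified g-side
LP at ν = 0.164) refutes the leaf and closes the route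
`refuted:NegWitness0164`; an exact re-evaluation of the spec showing F₀(1) > −1 (the Arb radius is
6·10⁻¹¹, so only a transcription error
can do this) kills NegWitness0164 — pivot to the coarser certified point 13/80 (F₀(1) = −1.02833,
margin 0.028, spec fspec_13_80_m27.json)
with the leaf instance changed by the lit seat. PrimeFreeOfWitnessAtEta is PROVED (cannot be refuted
short of an inconsistency).

NOT DECOMPOSED YET. The certificate format itself (the cell grid m = 24 of fspec_41_250_m24.json as
a `VecFn` step function, the finite list of cell integrals of
`blockWeight (1/2)` with rational two-sided enclosures, and the inequalities (i)–(iii) above as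
`norm_num` facts) is the prover's layer under
TweakNeg0164; the enclosure lemmas for the 𝓛_{1/2} cell integrals (dilogarithm-type values) are the
only non-mechanical part and are deliberately
not pre-typed here (their shape depends on how the prover evaluates `multiSlice` on step data).

CHEAPEST FALSIFIER. Re-run the referee's reproduction `kit j244135` (evidence/fm27_fcert.py on
fspec_41_250_m24.json; 3 core-min): F4 objective must print
f(1) = −1.0044719185 ± 1e−10 and F2 `0 FAIL` over the 73 families — DONE twice (j243625 by the cell,
j244135 by ref g7, PASS—REPRODUCED
2026-08-25T19:22Z). The next cheapest: `lean check` that `tweak_support` +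
`tweak_eq_zero_of_badSubsum` give the Type-II vanishing for a
3-vector (η, η, 1−2η) with B = {0} (a 15-line example) — if that fails, PrimeFreeOfWitnessAtEta
needs a new lemma.

NUMBERS. Printed window for ν*(1/2, 0): (0.1616, 0.1663] (FordMaynard2024PrimeSieves Thm 2.7
(b),(c); roots of their f, g: 0.1616912 / 0.1662296).
Cell, certified: no constant at 13/80 = 0.1625 (margin 0.0283) and at 41/250 = 0.164 (margin
0.00447); positive constant from 0.1651
(g-side, OBJ = 0.0027065 ± 4e−10, j242906; possibly 0.165 pending j243098). Honest FAIL at 0.1635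
non-lattice spec. Items at open: 4 (NegWitness0164 = the certificate; PrimeFreeOfWitnessAtEta
PROVED, kept as rank-3 item for the crux floor; NonposOfPrimeFree = landed p405250 by name, support;
assembly; all three statement items are binders of `closes`).

DEFINITION REQUESTS. None new: TypeIStarNegWitness / NoLowerSieveConstAt (p405840, LANDED
2026-08-25), PrimeFreeAdmissible, IsLowerSieveConst and
`IsLowerSieveConst.nonpos_of_primeFreeAdmissible` (p405250) exist. ALT-CLOSER (D-0061, class rung,
rung F-P1) — either of two registrations serves this route: (i) register THIS route's target decl
`Summit.Parity.GeneralizedHardyLittlewood.Theses.FordMaynardNoSieveConst0164.NoSieveConst0164`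
(precedents: Hodge H1/H2, YangMills R2a–d point at Theses decls; no file
landing needed), then `ledger route edit <id> --closes-target <that FQN> --closes-file glue.lean`;
or (ii) land the operator leaf
`Summit.Parity.GeneralizedHardyLittlewood.NoLowerSieveConst0164` (text
HOME/parity-ideate-lit/leaves/NoLowerSieveConst0164.lean, same body by `rfl`) and register it,
then the same edit with a glue ending `:= by unfold
Summit.Parity.GeneralizedHardyLittlewood.NoLowerSieveConst0164; exact hA …` and the target item
retriaged `aside`. The route is opened DRAFT before either (conclusion-mismatch by design).

Novelty: Searches (2026-08-25): `lit search --hybrid "Ford Maynard theory of prime detecting sieves Type II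
range threshold linear sieve constant" -n 8` (8 book hits: Harman 2007, Greaves, Friedlander–Iwaniec
Opera — none on the (1/2,0,ν) threshold) [corpus:book:harman2007-prime-detecting-sieves p.7]; `lit
citing arxiv:2407.14368` (1 citing paper: arXiv:2504.13195, R. Li 2025, triple (59/87, 28/87, 1/29)
— a different face of the polytope) [graph:arxiv:2504.13195]; `lit galaxy search "prime-detecting
sieve|Type II information|minimal Type II" --star all -n 10` (20 rows, only Harman's monograph
relevant) [galaxy:panama:397791281021019]; `lit search "prime producing sieves Type II information
threshold Ford Maynard" --source all --year-from 2024` (openalex/s2 rate-limited; arxiv 0, zbmath 0,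
crossref noise); `ledger negatives --problem Parity` (4, none related).
Nearest prior art found: FordMaynard2024PrimeSieves (arXiv:2407.14368) Theorem 2.7 (c) itself —
C⁻(1/2,0,0.1616) = 0 by an LP witness computed in Mathematica to 80 digits, no certificate published
beyond the ancillary data.
Delta: moves the printed (c)-side threshold 0.1616 to 0.164 (window (0.164, 0.1651] with the cell's
g-side) with exact-rational/Arb-ball certificates on finer LP families, and makes it a kernel target
over the tree's already-proved Ford–Maynard apparatus — after this seat's proof of Theorem 6.3 (b)
at (γ,0,η) only the finite certificate remains on that side.
Claimed grade: variant  [refs: 2407.14368, 2504.13195, book:harman2007-prime-detecting-sieves, arxiv:2407.14368, arxiv:2504.13195]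

Barriers (technique_class: sieve-lp-duality, certified-computation): - technique_class: sieve-lp-duality, certified-computation
- Literature.Barriers.Parity.FordMaynardMinimalTypeII: not evaded — USED: the route is an instance
of the Ford–Maynard negative direction (prime-free admissible sequences from a negative Type-I*
witness); the barrier says SOME Type-II information is necessary, the route quantifies how much at
level 1/2.
- Literature.Barriers.Parity.SelbergParityBarrier: consistent with it — the statement is a
NO-constant result (parity-type obstruction made quantitative), not a lower bound for primes.
- Literature.Barriers.Parity.LinearSieveOptimality: not applicable — that barrier concerns the
β-sieve without Type-II information; here the Type-II range [ν, 2ν] ∪ [1−2ν, 1−ν] is part of the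
hypothesis.
- Negatives index: empty near this line at filing (4 Parity negatives: Bateman–Horn variance,
SieveSequence parity, AffLinForm inverse theorem, shifted multiplication table — none involves
IsLowerSieveConst / PrimeFreeAdmissible).

History (route lifecycle, newest last):
- 2026-08-26T01:33:52Z · closes_target -> closes rung F-P1 of Parity: Summit.Parity.GeneralizedHardyLittlewood.Theses.FordMaynardNoSieveConst0164.NoSieveConst0164 (D-0061; not the summit Statement) (planner-parity-ideate-p3-g4-0)
- 2026-08-31T17:16:29Z · CLOSED proved — proved:Summit.Parity.GeneralizedHardyLittlewood.Theses.FordMaynardNoSieveConst0164.noSieveConst0164_proof (operator:999:3924921)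

sub-problem: GeneralizedHardyLittlewood · status: closed(proved) · opened planner-parity-ideate-p3-g2-0 2026-08-25T21:12:34Z · rev 1 · ledger route-Parity-FordMaynardNoSieveConst0164
GENERATED by the gate from the ledger (D-0016/17). Provers cite these decls: `theorem foo : Summit.Parity.GeneralizedHardyLittlewood.Theses.FordMaynardNoSieveConst0164.<Decl> := …` in Summits/Parity/GeneralizedHardyLittlewood/Theorems/<Name>.lean.
-/

namespace Summit.Parity.GeneralizedHardyLittlewood.Theses.FordMaynardNoSieveConst0164

open scoped BigOperators Topology Manifold Classical MeasureTheory ProbabilityTheory Matrix InnerProductSpace ComplexConjugate ContinuousMap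
open Filter Set Function TopologicalSpace MeasureTheory

attribute [summit_statement] _root_.GeneralizedHardyLittlewood
-- H21.Audit: the closer leaf Summit.Parity.GeneralizedHardyLittlewood.Theses.FordMaynardNoSieveConst0164.NoSieveConst0164 is an item decl of this route file — tagged summit_statement below, after its declaration

/-- item stmt-Parity-19101 · target · rank 0 · closed · proved by Summit.Parity.GeneralizedHardyLittlewood.Theses.FordMaynardNoSieveConst0164.noSieveConst0164_proof (prover) · by planner
why it might fail: only if the certificate NegWitness0164 is wrong (margin 0.0045, Arb radius 6·10⁻¹¹) — the two other items are PROVED.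
sources: FordMaynard2024PrimeSieves, arXiv:2407.14368
[target] the rung leaf itself, as this route's target item: no c > 0 is an admissible lower-bound
linear-sieve constant at (γ, θ, ν) = (1/2, 0, 41/250) — identical by `rfl` to the operator leaf
`Summit.Parity.GeneralizedHardyLittlewood.NoLowerSieveConst0164` if/when that is landed; registered
(or to be registered) as the rung's ALT-CLOSER (D-0061), after which `route edit --closes-target`
makes the route served. -/
@[route_item "route-Parity-FordMaynardNoSieveConst0164"]
def NoSieveConst0164 : Prop :=
  Literature.NumberTheory.Sieve.FordMaynard.NoLowerSieveConstAt (41 / 250)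

-- `NoSieveConst0164` holds: proved by `Summit.Parity.GeneralizedHardyLittlewood.Theses.FordMaynardNoSieveConst0164.noSieveConst0164_proof` (its module imports this route file, so no `_holds` link can be stated here).

/-- item stmt-Parity-19102 · crux · rank 2 · closed · proved by Summit.Parity.GeneralizedHardyLittlewood.Theses.FordMaynardNoSieveConst0164.negWitness0164_proof (prover) · by planner
why it might fail: the margin is 0.0045: the exact replay must bound the dimension-3..6 fragmentation integrals of the step data against the 𝓛-weights to < 4·10⁻³ total, and `MemTypeIStar.typeI` must hold EXACTLY (fsl-extension), not to Arb tolerance.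
sources: FordMaynard2024PrimeSieves, arXiv:2407.14368
[crux] there is f ∈ 𝔉*_η(γ) for η = 41/250, γ = 1/2 (symmetric, supported on {all ξᵢ ≥ η, Σξᵢ = 1},
bounded, piecewise Lipschitz, Type-I identity at level 1/2) with f(1) < −1 and f(β) ≥ −1 for every β
of dimension ≥ 2 — the fsl-extension of the cell's certified LP optimum F₀ (spec
fspec_41_250_m24.json: F₀(1) = −1.0044719185 ± 6.1e−11, F₀ ≥ −1 on the 73 cell families, kit j243625
/ j244135). [difficulty: L] -/
@[route_item "route-Parity-FordMaynardNoSieveConst0164", crux (experiment := "instrument: st0164_proof` carried by lean/Summits/Parity/GeneralizedHardyLittlewood/Theorems/FordMaynardNoSieveConst0164NoSieveConst0164.lean:30 (all f…") (source := "director PARITY l.17, 2026-09-01")]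
def NegWitness0164 : Prop :=
  Literature.NumberTheory.Sieve.FordMaynard.TypeIStarNegWitness (41 / 250) (1 / 2)

-- `NegWitness0164` holds: proved by `Summit.Parity.GeneralizedHardyLittlewood.Theses.FordMaynardNoSieveConst0164.negWitness0164_proof` (its module imports this route file, so no `_holds` link can be stated here).

/-- item stmt-Parity-19103 · crux · rank 3 · closed · proved by Summit.Parity.GeneralizedHardyLittlewood.Theses.FordMaynardNoSieveConst0164.primeFreeOfWitnessAtEta_holds (prover) · by planner
why it might fail: it cannot — PROVED (bc/PrimeFreeOfWitnessAtEta_holds.lean, rc 0, std axioms); the only residual risk is a farm/Mathlib drift before a prover lands the file (the proof uses only FordMaynardTweak/Construction lemmas by name).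
sources: FordMaynard2024PrimeSieves, arXiv:2407.14368
[crux] Theorem 6.3 (b) in exact form at P = (γ, 0, η): for 0 < γ < 1 and 0 < ν₀ < 1, a negative
Type-I* witness at (ν₀, γ) makes every B > 0 prime-free admissible for (γ, 0, ν₀) (some w_n with the
Type-I bound at level γ, the Type-II bound on [0, ν₀], Σ_{n ≤ x} w_n ≥ (1 − o(1)) x/log x and no
prime n^{1/B} ≤ p ≤ n in the support). PROVED by this seat (bc/PrimeFreeOfWitnessAtEta_holds.lean:
the tree's Theorem 9.1 proof `FordMaynardPrimeFreeOfTypeIStar_holds` with the Type-II bad interval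
replaced by the EDGE [η, η+ε] — on the tweak's support all components are ≥ η, so any proper subsum
≤ η+ε is a bad singleton — 136 lines, farm rc 0, 0 sorries, std axioms); kept as the rank-3 item
only because the rung is ONE certificate after the proved reductions (crux floor) — closable on day
1 by landing that file. [difficulty: provable-now] -/
@[route_item "route-Parity-FordMaynardNoSieveConst0164", crux (experiment := "instrument: arried by lean/Summits/Parity/GeneralizedHardyLittlewood/Theorems/FordMaynardNoSieveConst0164NoSieveConst0164.lean:30 (all four binders Ass…") (source := "director PARITY l.17, 2026-09-01")]
def PrimeFreeOfWitnessAtEta : Prop :=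
  ∀ γ ν₀ : ℝ, 0 < γ → γ < 1 → 0 < ν₀ → ν₀ < 1 → Literature.NumberTheory.Sieve.FordMaynard.TypeIStarNegWitness ν₀ γ → ∀ B : ℝ, Literature.Barriers.Parity.FordMaynard.PrimeFreeAdmissible γ 0 ν₀ B

-- `PrimeFreeOfWitnessAtEta` holds: proved by `Summit.Parity.GeneralizedHardyLittlewood.Theses.FordMaynardNoSieveConst0164.primeFreeOfWitnessAtEta_holds` (its module imports this route file, so no `_holds` link can be stated here).

/-- item stmt-Parity-19104 · support · rank 9 · closed · proved by Summit.Parity.GeneralizedHardyLittlewood.Theses.FordMaynardNoSieveConst0164.nonposOfPrimeFree_holds (prover) · by planner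
sources: FordMaynard2024PrimeSieves, arXiv:2407.14368
[support] the passage from prime-free admissible sequences to constants (Ford–Maynard's reading
`C⁻(P) = 0`, Definition 4.8): if for every B > 0 some (γ, θ, ν)-admissible weight sequence of mass ≥
(1 − o(1)) x/log x carries no prime, then every admissible lower-bound sieve constant c at (γ, θ, ν)
is ≤ 0. PROVED in the tree as `IsLowerSieveConst.nonpos_of_primeFreeAdmissible` (p405250, module
Literature.NumberTheory.Sieve.FordMaynardNoLowerSieveConst); filed as a by-name support (one
`exact`) so that the route file does not import that module (farm build of it pending at filing).
[difficulty: provable-now] -/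
@[route_item "route-Parity-FordMaynardNoSieveConst0164", crux (experiment := "instrument: arity/GeneralizedHardyLittlewood/Theorems/FordMaynardNoSieveConst0164NoSieveConst0164.lean:30 (all four binders Assembly/NegWitness0164/Pri…") (source := "director PARITY l.17, 2026-09-01")]
def NonposOfPrimeFree : Prop :=
  ∀ γ θ ν c : ℝ, (∀ B : ℝ, 0 < B → Literature.Barriers.Parity.FordMaynard.PrimeFreeAdmissible γ θ ν B) → Literature.NumberTheory.Sieve.FordMaynard.IsLowerSieveConst γ θ ν c → c ≤ 0

-- `NonposOfPrimeFree` holds: proved by `Summit.Parity.GeneralizedHardyLittlewood.Theses.FordMaynardNoSieveConst0164.nonposOfPrimeFree_holds` (its module imports this route file, so no `_holds` link can be stated here).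

/-- item stmt-Parity-19105 · assembly · rank 1 · closed · proved by Summit.Parity.GeneralizedHardyLittlewood.Theses.FordMaynardNoSieveConst0164.assembly_holds (prover) · by planner
sources: FordMaynard2024PrimeSieves
[assembly] NegWitness0164 → PrimeFreeOfWitnessAtEta → NonposOfPrimeFree → NoLowerSieveConst0164. -/
@[route_item "route-Parity-FordMaynardNoSieveConst0164", crux]
def Assembly : Prop :=
  NegWitness0164 → PrimeFreeOfWitnessAtEta → NonposOfPrimeFree → NoSieveConst0164

-- `Assembly` holds: proved by `Summit.Parity.GeneralizedHardyLittlewood.Theses.FordMaynardNoSieveConst0164.assembly_holds` (its module imports this route file, so no `_holds` link can be stated here).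

attribute [summit_statement] _root_.Summit.Parity.GeneralizedHardyLittlewood.Theses.FordMaynardNoSieveConst0164.NoSieveConst0164

/-! D-0027 §2.1 — DECIDING THEOREM (planner-authored via `route open/edit --closes-file`; by planner-parity-ideate-p3-g4-0 2026-08-26T01:33:52Z) — ARCHIVED: route closed (proved) 2026-08-31T17:16:29Z; kept so importers keep building:
its hypotheses are this route's items and its conclusion the registered leaf `Summit.Parity.GeneralizedHardyLittlewood.Theses.FordMaynardNoSieveConst0164.NoSieveConst0164` (rung F-P1, D-0061) (glue_lint), and it elaborates with this file. -/

@[closes "route-Parity-FordMaynardNoSieveConst0164"] theorem closes (hA : Assembly) (h1 : NegWitness0164) (h2 : PrimeFreeOfWitnessAtEta) (h3 : NonposOfPrimeFree) :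
    NoSieveConst0164 := hA h1 h2 h3

end Summit.Parity.GeneralizedHardyLittlewood.Theses.FordMaynardNoSieveConst0164
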